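import Summits.QuantumFields.BalabanUV.T4Continuum.Support.NE7ExpLogSecondOrder
import HarnessLib

/-!
# T⁴ programme, node NE3 — [B8] AT THE FLAT BACKGROUND, brick E (the exact Landau step), letter 1:
# STAR SECOND DIFFERENCES OF THE EXPONENTIAL — `‖Σᵢ (T(X + Yᵢ) − T X)‖ ≤ (e^ρ − 1)‖Σᵢ Yᵢ‖ + e^ρ·½Σᵢ‖Yᵢ‖²`
# for the exponential tail `T x = eˣ − 1 − x` in a Banach algebra (`FlatLandauExpStar`)

Cell `pub-balaban`, rung (B)+1 sub-cell t4, row NE3 (OWNER lineage `b2b-balaban-t4-ne3-p1`, generation 27; technique of record: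
implicit-function ∕ contraction mapping).  First file of the chain «BRICK E OF REP♭ AT FLAT PAIRS» — the EXACT nonlinear
(1.38)-Landau step of [Balaban1985RegularSpaces] («B8») Sect. E (Prop. 5, pp. 89–94) AT THE FLAT BACKGROUND `U₀ = 1` on the T⁴
programme's lattice, asked of «row NE3's owner» by the CRUX prover NE7 (HOME/INBOX [NE7P1-G72-INBOX-4]; crux card
`t4/b2b-balaban-t4-ne7-p1-g72/REP-FLAT-CRUX-CARD.md` N3; road `t4/b2b-balaban-t4-ne7-p1-g73/REP-FLAT-ROAD-v2.md` §3∕§4 brick E).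

WHY THIS LETTER.  One Newton step of the flat Landau scheme moves the field `U = e^{Z}` by the gauge transformation
`u = e^{λ}`, `λ ∈ N(Q′(1))`; the flat divergence of the new potential is `covDiv 1 Z + Δ_1 λ + (junk)`, and the junk must be
bounded by quantities PROPORTIONAL to `λ` with the LINEAR part in `Δ_1 λ` extracted EXACTLY — summed over the `2d` lattice
neighbours BEFORE taking norms (a neighbour-by-neighbour second-order bound costs `‖λ‖·‖∇λ‖ ≍ M³·‖Δλ‖²` per site and is NOT
uniform in the block size `M = L^k`; the star form costs `‖λ‖·‖Δλ‖ + ‖∇λ‖² ≍ M²‖Δλ‖²`, which is).  This file is that star form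
for the exponential tail; the parallelogram (4-point) form is the tree's `NE7ExpLogSecondOrder.norm_pg_expTail_le`
(t4-ne7-p2), whose series method is followed here word for word.

WHAT ([folklore]; complete normed `ℂ`-algebra `𝔸` with `‖1‖ = 1`; 0 def, 0 sorry):
* §1 `starSum_pow_succ` — the recursion `S_{m+1} = X·S_m + Σᵢ Yᵢ((X+Yᵢ)^m − X^m) + (Σᵢ Yᵢ)·X^m` for
  `S_m := Σᵢ ((X + Yᵢ)^m − X^m)`; **`norm_starSum_pow_le`** — on `‖X‖ ≤ ρ`, `‖X + Yᵢ‖ ≤ ρ`, `‖Σᵢ Yᵢ‖ ≤ δ`, `Σᵢ ‖Yᵢ‖² ≤ σ`: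
  `‖S_{k+2}‖ ≤ (k+2)ρ^{k+1}·δ + ((k+2)(k+1)∕2)·ρᵏ·σ` (induction on `k`).
* §2 **`norm_starSum_expTail_le`** — `‖Σᵢ (T(X + Yᵢ) − T X)‖ ≤ (e^ρ − 1)·δ + e^ρ·(σ∕2)`, `T x = eˣ − 1 − x` (termwise on the
  series `T x = Σ_{k≥0} x^{k+2}∕(k+2)!`, real majorant `Σ ρ^{k+1}δ∕(k+1)! + ρᵏ(σ∕2)∕k!`);
  `norm_starSum_exp_le` — the same for `eˣ` itself: `‖Σᵢ (e^{X+Yᵢ} − e^X) − Σᵢ Yᵢ‖ ≤ (e^ρ − 1)·δ + e^ρ·(σ∕2)`.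

HONEST FRAMING (page 1): elementary Banach-algebra analysis; nothing of Bałaban's is used, asserted or discharged; brick E is NOT
landed by this file (it is its first letter); REP♭ NOT proved; NE3 ∕ NE7 NOT proved; spine PROVED 0∕9; finite T⁴ rung (B)+1 —
NOT infinite volume, NOT mass gap, NOT `BetaPertH`, NOT Clay.  Continuum YM on T⁴ ⇐ BetaPertH ∧ nine spine estimates (0/9 proved);
BetaPertH ⇐ (D1) ∧ (D4) ∧ CAP+tail; G-an2-4 gates asym, D1 and NE2/3/4.  PLACEMENT: our lemma, `Spine/NE3/` (row NE3's [B8]-at-flat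
chain); imports `Support/NE7ExpLogSecondOrder` only.
-/

set_option autoImplicit false

open NormedSpace
open scoped BigOperators

namespace Summit.QuantumFields.BalabanUV.T4Continuum.NE3.FlatLandauExpStar

open Literature.MathematicalPhysics.QuantumFieldTheory.Balaban1983to89
open NE7ExpLogSecondOrder (hasSum_expTail hasSum_real_exp_shift_one)

noncomputable section

variable {𝔸 : Type*} [NormedRing 𝔸] [NormedAlgebra ℂ 𝔸] [CompleteSpace 𝔸] [NormOneClass 𝔸]
variable {ι : Type*}

/-! ## §1 Star sums of powers -/

omit [NormedAlgebra ℂ 𝔸] [CompleteSpace 𝔸] [NormOneClass 𝔸] in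
/-- The recursion of the star sum of powers: `Σᵢ ((X+Yᵢ)^{m+1} − X^{m+1}) = X·Σᵢ((X+Yᵢ)^m − X^m) + Σᵢ Yᵢ((X+Yᵢ)^m − X^m)
+ (Σᵢ Yᵢ)·X^m`. [folklore] -/
theorem starSum_pow_succ (s : Finset ι) (X : 𝔸) (Y : ι → 𝔸) (m : ℕ) :
    ∑ i ∈ s, ((X + Y i) ^ (m + 1) - X ^ (m + 1))
      = X * ∑ i ∈ s, ((X + Y i) ^ m - X ^ m) + ∑ i ∈ s, Y i * ((X + Y i) ^ m - X ^ m) + (∑ i ∈ s, Y i) * X ^ m := by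
  rw [Finset.mul_sum, Finset.sum_mul, ← Finset.sum_add_distrib, ← Finset.sum_add_distrib]
  refine Finset.sum_congr rfl fun i _ => ?_
  rw [pow_succ', pow_succ']
  noncomm_ring

omit [NormedAlgebra ℂ 𝔸] [CompleteSpace 𝔸] in
/-- **STAR SUMS OF POWERS TO SECOND ORDER**: on `‖X‖ ≤ ρ`, `‖X + Yᵢ‖ ≤ ρ` (`i ∈ s`), with `‖Σᵢ Yᵢ‖ ≤ δ` and `Σᵢ ‖Yᵢ‖² ≤ σ`:
`‖Σᵢ ((X+Yᵢ)^{k+2} − X^{k+2})‖ ≤ (k+2)·ρ^{k+1}·δ + ((k+2)(k+1)∕2)·ρᵏ·σ` — the linear part is taken on the SUM `Σᵢ Yᵢ`, the rest is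
quadratic in each `Yᵢ` (induction on `k` over `starSum_pow_succ`; first differences of powers by the tree's
`Literature.Analysis.Complex.norm_pow_succ_sub_pow_succ_le`). [folklore] -/
theorem norm_starSum_pow_le (s : Finset ι) {X : 𝔸} {Y : ι → 𝔸} {ρ δ σ : ℝ}
    (hX : ‖X‖ ≤ ρ) (hXY : ∀ i ∈ s, ‖X + Y i‖ ≤ ρ) (hδ : ‖∑ i ∈ s, Y i‖ ≤ δ) (hσ : ∑ i ∈ s, ‖Y i‖ ^ 2 ≤ σ) (k : ℕ) :
    ‖∑ i ∈ s, ((X + Y i) ^ (k + 2) - X ^ (k + 2))‖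
      ≤ (k + 2) * ρ ^ (k + 1) * δ + (k + 2) * (k + 1) / 2 * ρ ^ k * σ := by
  have hρ0 : 0 ≤ ρ := (norm_nonneg _).trans hX
  have hδ0 : 0 ≤ δ := (norm_nonneg _).trans hδ
  have hσ0 : 0 ≤ σ := le_trans (Finset.sum_nonneg fun i _ => sq_nonneg _) hσ
  -- first differences of powers: `‖(X+Yᵢ)^{m+1} − X^{m+1}‖ ≤ (m+1)ρ^m‖Yᵢ‖`
  have hP1 : ∀ {i : ι}, i ∈ s → ∀ m : ℕ, ‖(X + Y i) ^ (m + 1) - X ^ (m + 1)‖ ≤ (m + 1) * ρ ^ m * ‖Y i‖ := by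
    intro i hi m
    have h := Literature.Analysis.Complex.norm_pow_succ_sub_pow_succ_le (X + Y i) X m
    have hm0 : 0 ≤ max ‖X + Y i‖ ‖X‖ := (norm_nonneg _).trans (le_max_left _ _)
    have hsub : X + Y i - X = Y i := by abel
    rw [hsub] at h
    calc ‖(X + Y i) ^ (m + 1) - X ^ (m + 1)‖ ≤ (m + 1) * max ‖X + Y i‖ ‖X‖ ^ m * ‖Y i‖ := h
      _ ≤ (m + 1) * ρ ^ m * ‖Y i‖ := by gcongr; exact max_le (hXY i hi) hX
  induction k with
  | zero =>
    -- `(X+Y)² − X² = X·Y + Y·X + Y·Y`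
    have hid : ∑ i ∈ s, ((X + Y i) ^ (0 + 2) - X ^ (0 + 2)) = X * ∑ i ∈ s, Y i + (∑ i ∈ s, Y i) * X + ∑ i ∈ s, Y i * Y i := by
      rw [Finset.mul_sum, Finset.sum_mul, ← Finset.sum_add_distrib, ← Finset.sum_add_distrib]
      refine Finset.sum_congr rfl fun i _ => ?_
      rw [zero_add, sq, sq]
      noncomm_ring
    rw [hid]
    have h3 : ‖∑ i ∈ s, Y i * Y i‖ ≤ σ := by
      refine (norm_sum_le _ _).trans (le_trans (Finset.sum_le_sum fun i _ => ?_) hσ)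
      rw [sq]; exact norm_mul_le _ _
    calc ‖X * ∑ i ∈ s, Y i + (∑ i ∈ s, Y i) * X + ∑ i ∈ s, Y i * Y i‖
        ≤ ‖X * ∑ i ∈ s, Y i‖ + ‖(∑ i ∈ s, Y i) * X‖ + ‖∑ i ∈ s, Y i * Y i‖ := norm_add₃_le
      _ ≤ ‖X‖ * ‖∑ i ∈ s, Y i‖ + ‖∑ i ∈ s, Y i‖ * ‖X‖ + σ := by gcongr <;> exact norm_mul_le _ _
      _ ≤ ρ * δ + δ * ρ + σ := by gcongr
      _ = ((0 : ℕ) + 2 : ℝ) * ρ ^ (0 + 1) * δ + ((0 : ℕ) + 2 : ℝ) * ((0 : ℕ) + 1) / 2 * ρ ^ 0 * σ := by push_cast; ring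
  | succ k ih =>
    rw [show k + 1 + 2 = (k + 2) + 1 by omega, starSum_pow_succ]
    have hXk : ‖X ^ (k + 2)‖ ≤ ρ ^ (k + 2) := (norm_pow_le' _ (by omega)).trans (pow_le_pow_left₀ (norm_nonneg _) hX _)
    have h2 : ‖∑ i ∈ s, Y i * ((X + Y i) ^ (k + 2) - X ^ (k + 2))‖ ≤ (k + 2) * ρ ^ (k + 1) * σ := by
      calc ‖∑ i ∈ s, Y i * ((X + Y i) ^ (k + 2) - X ^ (k + 2))‖
          ≤ ∑ i ∈ s, ‖Y i‖ * ((k + 2) * ρ ^ (k + 1) * ‖Y i‖) := by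
            refine (norm_sum_le _ _).trans (Finset.sum_le_sum fun i hi => (norm_mul_le _ _).trans ?_)
            have h := hP1 hi (k + 1)
            rw [show k + 1 + 1 = k + 2 by omega] at h
            have h' : ‖(X + Y i) ^ (k + 2) - X ^ (k + 2)‖ ≤ (k + 2) * ρ ^ (k + 1) * ‖Y i‖ := by
              calc _ ≤ ((k + 1 : ℕ) + 1 : ℝ) * ρ ^ (k + 1) * ‖Y i‖ := h
                _ = (k + 2) * ρ ^ (k + 1) * ‖Y i‖ := by push_cast; ring
            exact mul_le_mul_of_nonneg_left h' (norm_nonneg _)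
        _ = (k + 2) * ρ ^ (k + 1) * ∑ i ∈ s, ‖Y i‖ ^ 2 := by rw [Finset.mul_sum]; refine Finset.sum_congr rfl fun i _ => ?_; ring
        _ ≤ (k + 2) * ρ ^ (k + 1) * σ := by gcongr
    calc ‖X * ∑ i ∈ s, ((X + Y i) ^ (k + 2) - X ^ (k + 2)) + ∑ i ∈ s, Y i * ((X + Y i) ^ (k + 2) - X ^ (k + 2))
          + (∑ i ∈ s, Y i) * X ^ (k + 2)‖
        ≤ ‖X * ∑ i ∈ s, ((X + Y i) ^ (k + 2) - X ^ (k + 2))‖ + ‖∑ i ∈ s, Y i * ((X + Y i) ^ (k + 2) - X ^ (k + 2))‖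
          + ‖(∑ i ∈ s, Y i) * X ^ (k + 2)‖ := norm_add₃_le
      _ ≤ ‖X‖ * ‖∑ i ∈ s, ((X + Y i) ^ (k + 2) - X ^ (k + 2))‖ + (k + 2) * ρ ^ (k + 1) * σ + ‖∑ i ∈ s, Y i‖ * ‖X ^ (k + 2)‖ := by
          gcongr
          · exact norm_mul_le _ _
          · exact norm_mul_le _ _
      _ ≤ ρ * ((k + 2) * ρ ^ (k + 1) * δ + (k + 2) * (k + 1) / 2 * ρ ^ k * σ) + (k + 2) * ρ ^ (k + 1) * σ + δ * ρ ^ (k + 2) := by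
          gcongr
      _ = ((k + 1 : ℕ) + 2 : ℝ) * ρ ^ (k + 1 + 1) * δ + ((k + 1 : ℕ) + 2 : ℝ) * ((k + 1 : ℕ) + 1) / 2 * ρ ^ (k + 1) * σ := by
          push_cast; ring

/-! ## §2 Star second differences of the exponential tail and of the exponential -/

/-- **STAR SECOND DIFFERENCES OF THE EXPONENTIAL TAIL** `T x = eˣ − 1 − x`: on `‖X‖ ≤ ρ`, `‖X + Yᵢ‖ ≤ ρ` (`i ∈ s`), with
`‖Σᵢ Yᵢ‖ ≤ δ` and `Σᵢ ‖Yᵢ‖² ≤ σ`: `‖Σᵢ (T(X + Yᵢ) − T X)‖ ≤ (e^ρ − 1)·δ + e^ρ·(σ∕2)` — the linear response of the tail is taken on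
the SUM of the increments.  Termwise on the series (`NE7ExpLogSecondOrder.hasSum_expTail`) by §1, with the real majorant
`Σ_k (ρ^{k+1}δ∕(k+1)! + ρᵏ(σ∕2)∕k!) = (e^ρ − 1)δ + e^ρ·σ∕2`. [folklore] -/
theorem norm_starSum_expTail_le (s : Finset ι) {X : 𝔸} {Y : ι → 𝔸} {ρ δ σ : ℝ}
    (hX : ‖X‖ ≤ ρ) (hXY : ∀ i ∈ s, ‖X + Y i‖ ≤ ρ) (hδ : ‖∑ i ∈ s, Y i‖ ≤ δ) (hσ : ∑ i ∈ s, ‖Y i‖ ^ 2 ≤ σ) :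
    ‖∑ i ∈ s, ((exp (X + Y i) - 1 - (X + Y i)) - (exp X - 1 - X))‖ ≤ (Real.exp ρ - 1) * δ + Real.exp ρ * (σ / 2) := by
  -- the series for the star sum of tails, termwise
  have hs : HasSum (fun k : ℕ => (((k + 2).factorial : ℂ)⁻¹) • ∑ i ∈ s, ((X + Y i) ^ (k + 2) - X ^ (k + 2)))
      (∑ i ∈ s, ((exp (X + Y i) - 1 - (X + Y i)) - (exp X - 1 - X))) := by
    have h : ∀ i ∈ s, HasSum (fun k : ℕ => (((k + 2).factorial : ℂ)⁻¹) • ((X + Y i) ^ (k + 2) - X ^ (k + 2)))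
        ((exp (X + Y i) - 1 - (X + Y i)) - (exp X - 1 - X)) := fun i _ => by
      simpa only [smul_sub] using (hasSum_expTail (X + Y i)).sub (hasSum_expTail X)
    simpa only [Finset.smul_sum] using hasSum_sum h
  -- the real majorant
  have hmaj : HasSum (fun k : ℕ => ρ ^ (k + 1) / ((k + 1).factorial : ℝ) * δ + ρ ^ k / (k.factorial : ℝ) * (σ / 2))
      ((Real.exp ρ - 1) * δ + Real.exp ρ * (σ / 2)) := by
    refine ((hasSum_real_exp_shift_one ρ).mul_right δ).add ?_
    have h : HasSum (fun n : ℕ => ρ ^ n / (n.factorial : ℝ)) (Real.exp ρ) := by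
      rw [Real.exp_eq_exp_ℝ]; exact expSeries_div_hasSum_exp ρ
    exact h.mul_right _
  refine hs.norm_le_of_bounded hmaj fun k => ?_
  rw [norm_smul, norm_inv, Complex.norm_natCast]
  have hk := norm_starSum_pow_le s hX hXY hδ hσ k
  have hfac1 : (((k + 2).factorial : ℕ) : ℝ) = (k + 2) * ((k + 1).factorial : ℝ) := by
    rw [show k + 2 = (k + 1) + 1 by omega, Nat.factorial_succ]; push_cast; ring
  have hfac2 : (((k + 1).factorial : ℕ) : ℝ) = (k + 1) * (k.factorial : ℝ) := by
    rw [Nat.factorial_succ]; push_cast; ring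
  have hf0 : (k.factorial : ℝ) ≠ 0 := by positivity
  have hf1 : ((k + 1).factorial : ℝ) ≠ 0 := by positivity
  have hk1 : (k : ℝ) + 1 ≠ 0 := by positivity
  have hk2 : (k : ℝ) + 2 ≠ 0 := by positivity
  have h1 : (((k + 2).factorial : ℕ) : ℝ)⁻¹ * ((k : ℝ) + 2) = (((k + 1).factorial : ℕ) : ℝ)⁻¹ := by
    rw [hfac1]; field_simp
  have h2 : (((k + 2).factorial : ℕ) : ℝ)⁻¹ * (((k : ℝ) + 2) * ((k : ℝ) + 1)) = ((k.factorial : ℕ) : ℝ)⁻¹ := by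
    rw [hfac1, hfac2]; field_simp
  calc (((k + 2).factorial : ℝ))⁻¹ * ‖∑ i ∈ s, ((X + Y i) ^ (k + 2) - X ^ (k + 2))‖
      ≤ (((k + 2).factorial : ℝ))⁻¹ * ((k + 2) * ρ ^ (k + 1) * δ + (k + 2) * (k + 1) / 2 * ρ ^ k * σ) := by gcongr
    _ = ρ ^ (k + 1) / ((k + 1).factorial : ℝ) * δ + ρ ^ k / (k.factorial : ℝ) * (σ / 2) := by
        rw [div_eq_inv_mul, div_eq_inv_mul]
        linear_combination (ρ ^ (k + 1) * δ) * h1 + (ρ ^ k * (σ / 2)) * h2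

/-- **STAR SECOND DIFFERENCES OF THE EXPONENTIAL**: `‖Σᵢ (e^{X+Yᵢ} − e^X) − Σᵢ Yᵢ‖ ≤ (e^ρ − 1)·δ + e^ρ·(σ∕2)` under the hypotheses
of `norm_starSum_expTail_le` (`e^{X+Y} − e^X − Y = T(X+Y) − T X`). [folklore] -/
theorem norm_starSum_exp_le (s : Finset ι) {X : 𝔸} {Y : ι → 𝔸} {ρ δ σ : ℝ}
    (hX : ‖X‖ ≤ ρ) (hXY : ∀ i ∈ s, ‖X + Y i‖ ≤ ρ) (hδ : ‖∑ i ∈ s, Y i‖ ≤ δ) (hσ : ∑ i ∈ s, ‖Y i‖ ^ 2 ≤ σ) :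
    ‖∑ i ∈ s, (exp (X + Y i) - exp X) - ∑ i ∈ s, Y i‖ ≤ (Real.exp ρ - 1) * δ + Real.exp ρ * (σ / 2) := by
  have hid : ∑ i ∈ s, (exp (X + Y i) - exp X) - ∑ i ∈ s, Y i
      = ∑ i ∈ s, ((exp (X + Y i) - 1 - (X + Y i)) - (exp X - 1 - X)) := by
    rw [← Finset.sum_sub_distrib]
    refine Finset.sum_congr rfl fun i _ => ?_
    abel
  rw [hid]
  exact norm_starSum_expTail_le s hX hXY hδ hσ

end

end Summit.QuantumFields.BalabanUV.T4Continuum.NE3.FlatLandauExpStar
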